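import Summits.MatrixMultiplication.OmegaCensus.STPPKernelListerOrderLaw43
import Summits.MatrixMultiplication.OmegaCensus.STPPKernelListerOrderN35
import Summits.MatrixMultiplication.OmegaCensus.STPPKernelListerOrderN36

/-!
# ω-census (abelian STPP census): NO beating STPP family in ANY abelian group of order `≤ 41`, and of order `≤ 43` except `42` (kernel, unconditional)

HONEST FRAMING (pub-omega census; verbatim): lottery ticket; floor = certified bounds/negative ranges.
Census STRUCTURE (seat pub-omega-stpp-2 gen 31, 2026-08-29), family (b2).  `volume_le_card_of_card_le_43` (stpp-2 g30: orders `≤ 43` except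
`33, 35, 36, 42`) with three of its four exceptions REMOVED by this seat's unconditional capstones `volume_le_of_card_eq_33` (N20 order-three clash),
`volume_le_of_card_eq_35` (cross-reading coset clashes), `volume_le_of_card_eq_36` (Sylow coset clash): for every finite abelian group `H` with
`|H| ≤ 41`, or `|H| ≤ 43` and `|H| ≠ 42`, every simultaneous-triple-product family `(Aᵢ, Bᵢ, Cᵢ)_{i<m}` (CKSU Def. 5.1; any `m`, any sizes) has
`Σ |Aᵢ||Bᵢ||Cᵢ| ≤ |H|`.  Order `42` (`ℤ₄₂` only) stays conditional on `{233_333, 223_242_422}` (`…OrderN42DP2.lean`; `111_233_234` dies by the coset clash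
but is not filed separately).  Nothing here is progress on `ω`.

References: M. Kneser, Math. Z. 58 (1953); H. Cohn, R. Kleinberg, B. Szegedy, C. Umans, FOCS 2005 (arXiv:math/0511460), Def. 5.1.
-/

open Finset

namespace Summit.MatrixMultiplication.OmegaCensus.KLister

open Literature.Computability.AlgebraicComplexity

/-- **Every abelian group of order `≤ 43` other than `42` admits no beating STPP family.** [cite: CohnKleinbergSzegedyUmans2005, Def. 5.1] -/
theorem volume_le_card_of_card_le_43_ne_42 {H : Type*} [AddCommGroup H] [Fintype H] [DecidableEq H] (h43 : Fintype.card H ≤ 43)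
    (h42 : Fintype.card H ≠ 42) {m : ℕ} (A B C : Fin m → Finset H) (hS : IsSTPP A B C) :
    ∑ i, #(A i) * #(B i) * #(C i) ≤ Fintype.card H := by
  by_cases h33 : Fintype.card H = 33
  · rw [h33]; exact volume_le_of_card_eq_33 h33 A B C hS
  by_cases h35 : Fintype.card H = 35
  · rw [h35]; exact volume_le_of_card_eq_35 h35 A B C hS
  by_cases h36 : Fintype.card H = 36
  · rw [h36]; exact volume_le_of_card_eq_36 h36 A B C hS
  exact volume_le_card_of_card_le_43 h43 h33 h35 h36 h42 A B C hS

/-- **Every abelian group of order `≤ 41` admits no beating STPP family.** [cite: CohnKleinbergSzegedyUmans2005, Def. 5.1] -/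
theorem volume_le_card_of_card_le_41 {H : Type*} [AddCommGroup H] [Fintype H] [DecidableEq H] (h41 : Fintype.card H ≤ 41)
    {m : ℕ} (A B C : Fin m → Finset H) (hS : IsSTPP A B C) : ∑ i, #(A i) * #(B i) * #(C i) ≤ Fintype.card H :=
  volume_le_card_of_card_le_43_ne_42 (by omega) (by omega) A B C hS

end Summit.MatrixMultiplication.OmegaCensus.KLister
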